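import Mathlib
import Summits.AtomisticToContinuum.Crystallization.Theses.ReggeStarCoercivity
import Literature.Geometry.DiscreteGeometry.SolidAngleFraction
import Literature.Geometry.DiscreteGeometry.ConeTiling

/-!
# Solid-angle flatness at a vertex (route `ReggeStarCoercivity`, item `SolidAngleFlatness`)

Settles `stmt-AtomisticToContinuum-13607`
(`Summit.AtomisticToContinuum.Crystallization.Theses.ReggeStarCoercivity.SolidAngleFlatness`):
for finitely many non-degenerate tetrahedra `conv(v, p k 0, p k 1, p k 2)` with common apex `v` and
pairwise disjoint interiors, the unit-ball volume fractions at `v` of their apex cones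
`{v + ∑ cᵢ (p k i − v) : cᵢ ≥ 0}` (normalised solid angles) sum to `≤ 1`, with equality when the
tetrahedra cover a neighbourhood of `v`.

PROOF (pure measure theory, as announced in the item). The summands are literally
`ballFraction v (apexCone v (p k · − v))` (`Literature/Geometry/DiscreteGeometry/SolidAngleFraction`),
so both conjuncts are the additivity lemmas `sum_ballFraction_le_one` /
`sum_ballFraction_eq_one_of_ball_subset` of `Literature/Geometry/DiscreteGeometry/ConeTiling`, once
we know (i) each cone is measurable, (ii) two of the cones meet in a null set, (iii) under the
covering hypothesis the cones cover the unit ball.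
(i) The cone is the translate by `v` of the image of the closed orthant of `ℝ³` under the linear
map `c ↦ ∑ cᵢ uᵢ`, which is a closed embedding because the `uᵢ = p k i − v` are linearly
independent. (ii) Near the apex the cone lies inside its tetrahedron
(`exists_apexCone_inter_ball_subset`: an injective linear map on a finite-dimensional space is
bounded below, so small points of the cone have coefficient sum `≤ 1`); two convex sets with
disjoint interiors meet in a null set (the intersection is convex with empty interior, hence inside
its own frontier, which is null by `Convex.addHaar_frontier`); and a set invariant under dilations
about `v` that is null near `v` is null (countably many homothetic images). (iii) Tetrahedra lie in
their cones and cones are dilation invariant.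
-/

noncomputable section

namespace Summit.AtomisticToContinuum.Crystallization.Theorems

open MeasureTheory Metric Set
open Literature.Geometry.DiscreteGeometry

/-- An apex cone `{v + ∑ cᵢ uᵢ : cᵢ ≥ 0}` is convex. -/
theorem convex_apexCone {V : Type*} [AddCommGroup V] [Module ℝ V] {ι : Type*} [Fintype ι]
    (v : V) (u : ι → V) : Convex ℝ (apexCone v u) := by
  rintro _ ⟨a, ha, rfl⟩ _ ⟨b, hb, rfl⟩ s t hs ht hst
  refine ⟨fun i => s * a i + t * b i,
    fun i => add_nonneg (mul_nonneg hs (ha i)) (mul_nonneg ht (hb i)), ?_⟩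
  have hv : s • v + t • v = v := by rw [← add_smul, hst, one_smul]
  simp only [smul_add, Finset.smul_sum, smul_smul, add_smul, Finset.sum_add_distrib]
  conv_rhs => rw [← hv]
  abel

/-- The tetrahedron `conv(v, p 0, p 1, p 2)` lies in the apex cone at `v` spanned by the
`p i − v`. -/
theorem convexHull_subset_apexCone (v : EuclideanSpace ℝ (Fin 3))
    (p : Fin 3 → EuclideanSpace ℝ (Fin 3)) :
    convexHull ℝ (insert v (range p)) ⊆ apexCone v (fun i => p i - v) := by
  refine convexHull_min ?_ (convex_apexCone v _)
  rintro x (rfl | ⟨i, rfl⟩)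
  · exact self_mem_apexCone _ _
  · simpa using add_mem_apexCone v (fun j => p j - v) i

/-- **Near the apex the cone lies in the tetrahedron**: if the `p i − v` are linearly independent
there is `δ > 0` with `apexCone v (p · − v) ∩ B(v, δ) ⊆ conv(v, p 0, p 1, p 2)`. -/
theorem exists_apexCone_inter_ball_subset (v : EuclideanSpace ℝ (Fin 3))
    (p : Fin 3 → EuclideanSpace ℝ (Fin 3)) (hli : LinearIndependent ℝ (fun i => p i - v)) :
    ∃ δ : ℝ, 0 < δ ∧
      apexCone v (fun i => p i - v) ∩ ball v δ ⊆ convexHull ℝ (insert v (range p)) := by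
  have hker : LinearMap.ker (Fintype.linearCombination ℝ (fun i => p i - v)) = ⊥ := by
    rw [LinearMap.ker_eq_bot']
    intro c hc
    funext i
    exact Fintype.linearIndependent_iff.1 hli c hc i
  obtain ⟨K, hK, hanti⟩ :=
    LinearMap.exists_antilipschitzWith (Fintype.linearCombination ℝ (fun i => p i - v)) hker
  have hK' : (0 : ℝ) < K := NNReal.coe_pos.2 hK
  refine ⟨1 / (3 * K), div_pos one_pos (mul_pos (by norm_num) hK'), ?_⟩
  rintro q ⟨⟨c, hc, rfl⟩, hq⟩
  -- the norm of the point controls the coefficients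
  have hdist : ‖∑ i, c i • (p i - v)‖ < 1 / (3 * K) := by
    rwa [mem_ball, dist_eq_norm, add_sub_cancel_left] at hq
  have hnorm : ‖c‖ ≤ K * ‖∑ i, c i • (p i - v)‖ := by
    have h := hanti.le_mul_dist c 0
    simpa [dist_zero_right, Fintype.linearCombination_apply] using h
  have hc3 : ‖c‖ < 1 / 3 := by
    have h1 : (K : ℝ) * ‖∑ i, c i • (p i - v)‖ < K * (1 / (3 * K)) :=
      mul_lt_mul_of_pos_left hdist hK'
    have h2 : (K : ℝ) * (1 / (3 * K)) = 1 / 3 := by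
      field_simp
    linarith
  have hci : ∀ i, c i ≤ ‖c‖ := fun i =>
    (le_abs_self _).trans ((Real.norm_eq_abs (c i)).symm.le.trans (norm_le_pi_norm c i))
  have hsum : ∑ i, c i ≤ 1 := by
    have h3 : ∑ i, c i ≤ ∑ _i : Fin 3, ‖c‖ := Finset.sum_le_sum fun i _ => hci i
    simp only [Finset.sum_const, Finset.card_univ, Fintype.card_fin, nsmul_eq_mul,
      Nat.cast_ofNat] at h3
    linarith
  -- hence the point is a convex combination of `v` and the `p i`
  have hz : ∀ o : Option (Fin 3), (o.elim v p) ∈ convexHull ℝ (insert v (range p)) := by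
    rintro (_ | i)
    · exact subset_convexHull ℝ _ (mem_insert _ _)
    · exact subset_convexHull ℝ _ (mem_insert_of_mem _ (mem_range_self i))
  have hw0 : ∀ o : Option (Fin 3), 0 ≤ (o.elim (1 - ∑ i, c i) c : ℝ) := by
    rintro (_ | i)
    · simpa using hsum
    · exact hc i
  have hw1 : ∑ o : Option (Fin 3), (o.elim (1 - ∑ i, c i) c : ℝ) = 1 := by
    simp [Fintype.sum_option]
  have hmem := (convex_convexHull ℝ (insert v (range p))).sum_mem (t := Finset.univ)
    (w := fun o : Option (Fin 3) => (o.elim (1 - ∑ i, c i) c : ℝ))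
    (z := fun o : Option (Fin 3) => o.elim v p) (fun o _ => hw0 o) hw1 (fun o _ => hz o)
  convert hmem using 1
  simp only [Fintype.sum_option, Option.elim_none, Option.elim_some, smul_sub,
    Finset.sum_sub_distrib, sub_smul, one_smul, Finset.sum_smul]
  abel

/-- Two convex sets with disjoint interiors meet in a Lebesgue-null set. -/
theorem volume_inter_eq_zero_of_interior_inter_eq_empty
    {s t : Set (EuclideanSpace ℝ (Fin 3))} (hs : Convex ℝ s) (ht : Convex ℝ t)
    (hst : interior s ∩ interior t = ∅) : volume (s ∩ t) = 0 := by
  have h := (hs.inter ht).addHaar_frontier volume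
  rw [frontier, interior_inter, hst, sdiff_empty] at h
  exact measure_mono_null subset_closure h

/-- A set invariant under dilations about `v` which is null near `v` is null. -/
theorem volume_eq_zero_of_dilation_invariant {W : Set (EuclideanSpace ℝ (Fin 3))}
    (v : EuclideanSpace ℝ (Fin 3)) (hW : ∀ x ∈ W, ∀ t : ℝ, 0 < t → v + t • (x - v) ∈ W)
    {δ : ℝ} (hδ : 0 < δ) (h0 : volume (W ∩ ball v δ) = 0) : volume W = 0 := by
  have hcover : W ⊆ ⋃ m : ℕ, AffineMap.homothety v ((m : ℝ) + 1) '' (W ∩ ball v δ) := by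
    intro x hx
    obtain ⟨m, hm⟩ := exists_nat_gt (dist x v / δ)
    have hlt : dist x v < ((m : ℝ) + 1) * δ := by
      have : dist x v / δ < (m : ℝ) + 1 := hm.trans (lt_add_one _)
      rwa [div_lt_iff₀ hδ] at this
    have hm0 : (0 : ℝ) < (m : ℝ) + 1 := by positivity
    refine mem_iUnion.2 ⟨m, AffineMap.homothety v ((m : ℝ) + 1)⁻¹ x, ⟨?_, ?_⟩, ?_⟩
    · have := hW x hx ((m : ℝ) + 1)⁻¹ (inv_pos.2 hm0)
      simpa [AffineMap.homothety_apply, add_comm] using this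
    · rw [mem_ball, dist_homothety_center, Real.norm_eq_abs, abs_of_pos (inv_pos.2 hm0), dist_comm,
        inv_mul_lt_iff₀ hm0]
      exact hlt
    · rw [← AffineMap.homothety_mul_apply, mul_inv_cancel₀ hm0.ne', AffineMap.homothety_one]
      rfl
  refine measure_mono_null hcover (measure_iUnion_null_iff.2 fun m => ?_)
  rw [Measure.addHaar_image_homothety, h0, mul_zero]

/-- **Apex cones of interior-disjoint tetrahedra meet in a null set.** -/
theorem volume_apexCone_inter_apexCone_eq_zero (v : EuclideanSpace ℝ (Fin 3))
    (p q : Fin 3 → EuclideanSpace ℝ (Fin 3)) (hp : LinearIndependent ℝ (fun i => p i - v))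
    (hq : LinearIndependent ℝ (fun i => q i - v))
    (hdisj : interior (convexHull ℝ (insert v (range p))) ∩
      interior (convexHull ℝ (insert v (range q))) = ∅) :
    volume (apexCone v (fun i => p i - v) ∩ apexCone v (fun i => q i - v)) = 0 := by
  obtain ⟨δ₁, hδ₁, h₁⟩ := exists_apexCone_inter_ball_subset v p hp
  obtain ⟨δ₂, hδ₂, h₂⟩ := exists_apexCone_inter_ball_subset v q hq
  refine volume_eq_zero_of_dilation_invariant v ?_ (lt_min hδ₁ hδ₂) ?_
  · rintro x ⟨hxp, hxq⟩ t ht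
    exact ⟨add_smul_sub_mem_apexCone hxp ht.le, add_smul_sub_mem_apexCone hxq ht.le⟩
  · refine measure_mono_null ?_ (volume_inter_eq_zero_of_interior_inter_eq_empty
      (convex_convexHull ℝ _) (convex_convexHull ℝ _) hdisj)
    rintro x ⟨⟨hxp, hxq⟩, hx⟩
    exact ⟨h₁ ⟨hxp, ball_subset_ball (min_le_left _ _) hx⟩,
      h₂ ⟨hxq, ball_subset_ball (min_le_right _ _) hx⟩⟩

/-- The apex cone spanned by three linearly independent vectors is closed (hence measurable). -/
theorem isClosed_apexCone (v : EuclideanSpace ℝ (Fin 3)) {u : Fin 3 → EuclideanSpace ℝ (Fin 3)}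
    (hu : LinearIndependent ℝ u) : IsClosed (apexCone v u) := by
  have hker : LinearMap.ker (Fintype.linearCombination ℝ u) = ⊥ := by
    rw [LinearMap.ker_eq_bot']
    intro c hc
    funext i
    exact Fintype.linearIndependent_iff.1 hu c hc i
  have hemb := LinearMap.isClosedEmbedding_of_injective hker
  have hO : IsClosed {c : Fin 3 → ℝ | ∀ i, 0 ≤ c i} := by
    rw [setOf_forall]
    exact isClosed_iInter fun i => isClosed_le continuous_const (continuous_apply i)
  have h1 : IsClosed ((Fintype.linearCombination ℝ u) '' {c : Fin 3 → ℝ | ∀ i, 0 ≤ c i}) :=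
    hemb.isClosedMap _ hO
  have h2 : apexCone v u =
      (Homeomorph.addLeft v) '' ((Fintype.linearCombination ℝ u) '' {c | ∀ i, 0 ≤ c i}) := by
    ext x
    simp only [apexCone, image_image, mem_image, mem_setOf_eq, Homeomorph.coe_addLeft,
      Fintype.linearCombination_apply]
    constructor
    · rintro ⟨c, hc, rfl⟩
      exact ⟨c, hc, rfl⟩
    · rintro ⟨c, hc, rfl⟩
      exact ⟨c, hc, rfl⟩
  rw [h2]
  exact (Homeomorph.addLeft v).isClosed_image.2 h1

/-- **Solid-angle flatness at a vertex** (item `stmt-AtomisticToContinuum-13607`): the normalised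
solid angles at a common apex of finitely many non-degenerate, interior-disjoint tetrahedra sum to
at most `1`, and to exactly `1` when the tetrahedra cover a neighbourhood of the apex. -/
theorem solidAngleFlatness_proof :
    Summit.AtomisticToContinuum.Crystallization.Theses.ReggeStarCoercivity.SolidAngleFlatness := by
  intro n v p hli hdisj
  have hmeas : ∀ k ∈ (Finset.univ : Finset (Fin n)),
      MeasurableSet (apexCone v (fun i => p k i - v)) :=
    fun k _ => (isClosed_apexCone v (hli k)).measurableSet
  have hnull : ((Finset.univ : Finset (Fin n)) : Set (Fin n)).Pairwise fun k l =>
      volume (apexCone v (fun i => p k i - v) ∩ apexCone v (fun i => p l i - v)) = 0 :=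
    fun k _ l _ hkl =>
      volume_apexCone_inter_apexCone_eq_zero v (p k) (p l) (hli k) (hli l) (hdisj k l hkl)
  refine ⟨?_, ?_⟩
  · exact sum_ballFraction_le_one Finset.univ v hmeas hnull
  · rintro ⟨r, hr, hcov⟩
    refine sum_ballFraction_eq_one_of_ball_subset Finset.univ v hmeas hnull ?_
    intro x hx
    have hy : v + r • (x - v) ∈ ball v r := by
      rw [mem_ball, dist_eq_norm, add_sub_cancel_left, norm_smul, Real.norm_eq_abs, abs_of_pos hr,
        ← dist_eq_norm]
      exact mul_lt_of_lt_one_right hr (mem_ball.1 hx)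
    obtain ⟨k, hk⟩ := mem_iUnion.1 (hcov hy)
    have hk' : v + r • (x - v) ∈ apexCone v (fun i => p k i - v) :=
      convexHull_subset_apexCone v (p k) hk
    have := add_smul_sub_mem_apexCone hk' (inv_nonneg.2 hr.le)
    rw [add_sub_cancel_left, smul_smul, inv_mul_cancel₀ hr.ne', one_smul, add_sub_cancel] at this
    exact mem_iUnion₂.2 ⟨k, Finset.mem_univ k, this⟩

end Summit.AtomisticToContinuum.Crystallization.Theorems

end
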